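import Literature.MathematicalPhysics.QuantumFieldTheory.QCDPropagatorNeighbourhoodLowerBound
import Literature.MathematicalPhysics.QuantumFieldTheory.QCDPhaseQuenchedTranslation
import HarnessLib

/-!
# Parity of phase-quenched quark-propagator moments (γ₅-hermiticity) and the folded star bound

Topic `Literature/MathematicalPhysics/QuantumFieldTheory`; namespace
`Literature.MathematicalPhysics.QuantumFieldTheory`.  Companion of
`QCDPropagatorNeighbourhoodLowerBound.lean` (the star sum rule: the nine phase-quenched fractional
moments of the Wilson quark propagator on the unit star of the source cannot all be small) and of
`QCDPhaseQuenchedTranslation.lean` (translation invariance of those moments).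

* §1 (linear algebra): if a square complex matrix `A` is sign-conjugate to its adjoint,
  `diag(ε) A diag(ε) = Aᴴ` with `ε_i² = 1`, `|ε_i| = 1`, then the entry moduli of `A⁻¹` are
  SYMMETRIC, `|A⁻¹(p,q)| = |A⁻¹(q,p)|` (`(A⁻¹)ᴴ = diag(ε) A⁻¹ diag(ε)`; Mathlib's `Matrix.inv`, so no
  invertibility hypothesis is needed).
* §2 (one flavour, any unitary colour representation, any periodic four-torus, any gauge field, any
  real `m`, `r`): γ₅-hermiticity `γ₅ D_W γ₅ = D_W†` (tree `wilsonDirac_gammaFive_hermitian_holds`,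
  `γ₅ = diag(1,1,-1,-1)` in the chiral basis) gives `|D_W⁻¹(p,q)| = |D_W⁻¹(q,p)|`
  (`norm_inv_wilsonDirac_apply_comm`); the same for the tree's flavour-diagonal `N_f`-flavour matrix
  `diracMatrix` (`diracMatrix_signConj`, `norm_inv_diracMatrix_apply_comm`; the sign of a quark index is
  `(1,1,-1,-1)` at its spin, read through the fixed enumeration `quarkEquiv`).
* §3 (`N_f` flavours, `SU(3)`, the literal `|det|`-weighted Wilson integrals of the QCD theses):
  the phase-quenched moment of the colour–spin entry sum `Σ_{a,i,b,j}|G_f((x,a,i),(y,b,j))|` is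
  symmetric under `x ↔ y` (`phaseQuenched_twoPoint_swap`, configuration-wise) and hence, by
  translation invariance, EVEN in the separation: the moment at `(0, −v)` equals the moment at
  `(0, v)` (`phaseQuenched_twoPoint_neg`).
* §4 the FOLDED STAR BOUND: for `0 < s ≤ 1`, every bare-mass tuple, coupling, volume and flavour,
  `12^s ≤ |m_f+4|^s · E_{|w|}[(Σ|G_f(0,0)|)^s] + 2 Σ_μ E_{|w|}[(Σ|G_f(0,μ̂)|)^s]`
  (`phaseQuenched_starMoment_ge_folded`): the eight neighbour terms of
  `phaseQuenched_starMoment_ge` reduce to the four forward ones.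

Elementary; written for the harness by a stub-worker of prover-line-stmt-QuantumFields-9150-0 (crux
`WilsonMobilityGap.MobilityGap`, line `Sketch`, 2026-08-16) while delimiting the `n ∈ {0,1}` corner of
that crux's lower pin (iii).  Not here: the reduction of the four directions to one (the entry sum
`Σ|G|` is an `ℓ¹` norm in the chiral spin basis and is NOT invariant under the spinor rotations that
implement axis permutations — only comparable within a factor `12`), any bound on a single moment at
bare mass `≤ 0`.
-/

noncomputable section

namespace Literature.MathematicalPhysics.QuantumFieldTheory

open scoped BigOperators
open MeasureTheory Filter
open Literature.MathematicalPhysics.QuantumLattice Literature.Probability.LatticeModels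
open Matrix

/-! ### §1 Sign-conjugate matrices: the inverse has symmetric entry moduli -/

/-- If `diag(ε) A diag(ε) = Aᴴ` for a sign vector `ε` (`ε_i ε_i = 1`, `‖ε_i‖ = 1`), then
`(A⁻¹)ᴴ = diag(ε) A⁻¹ diag(ε)` (Mathlib's `Matrix.inv`; no invertibility needed). [folklore] -/
theorem conjTranspose_inv_of_signConj {n : Type*} [Fintype n] [DecidableEq n] (ε : n → ℂ)
    (hε : ∀ i, ε i * ε i = 1) (A : Matrix n n ℂ) (hA : diagonal ε * A * diagonal ε = Aᴴ) :
    A⁻¹ᴴ = diagonal ε * A⁻¹ * diagonal ε := by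
  have hΓ : diagonal ε * diagonal ε = (1 : Matrix n n ℂ) := by
    rw [diagonal_mul_diagonal, ← diagonal_one]
    congr 1
    funext i
    exact hε i
  have hΓinv : (diagonal ε)⁻¹ = diagonal ε := inv_eq_left_inv hΓ
  rw [conjTranspose_nonsing_inv, ← hA, Matrix.mul_inv_rev, Matrix.mul_inv_rev, hΓinv, Matrix.mul_assoc]

/-- **Symmetric entry moduli of the inverse of a sign-conjugate matrix**: if
`diag(ε) A diag(ε) = Aᴴ` with `ε_i ε_i = 1`, `‖ε_i‖ = 1`, then `‖A⁻¹(p,q)‖ = ‖A⁻¹(q,p)‖`. [folklore] -/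
theorem norm_inv_apply_comm_of_signConj {n : Type*} [Fintype n] [DecidableEq n] (ε : n → ℂ)
    (hε : ∀ i, ε i * ε i = 1) (hε1 : ∀ i, ‖ε i‖ = 1) (A : Matrix n n ℂ)
    (hA : diagonal ε * A * diagonal ε = Aᴴ) (p q : n) : ‖A⁻¹ p q‖ = ‖A⁻¹ q p‖ := by
  have h := conjTranspose_inv_of_signConj ε hε A hA
  have h' := congr_fun (congr_fun h q) p
  rw [conjTranspose_apply, mul_diagonal, diagonal_mul] at h'
  -- `h' : star (A⁻¹ p q) = ε q * A⁻¹ q p * ε p`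
  calc ‖A⁻¹ p q‖ = ‖star (A⁻¹ p q)‖ := (norm_star _).symm
    _ = ‖ε q * A⁻¹ q p * ε p‖ := by rw [h']
    _ = ‖A⁻¹ q p‖ := by rw [norm_mul, norm_mul, hε1, hε1, one_mul, mul_one]

/-! ### §2 The Wilson–Dirac operator and the `N_f`-flavour matrix -/

section Torus

variable {L N : ℕ} [NeZero L] {G : Type*} [Group G] (ρ : G →* Matrix (Fin N) (Fin N) ℂ)

/-- The `γ₅` sign vector squares to one. [folklore] -/
private theorem parity_gammaFiveSign_sq (α : Fin 4) :
    (![1, 1, -1, -1] : Fin 4 → ℂ) α * (![1, 1, -1, -1] : Fin 4 → ℂ) α = 1 :=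
  gammaFiveSign_mul_self α

/-- The `γ₅` sign vector has unit modulus. [folklore] -/
private theorem parity_norm_gammaFiveSign (α : Fin 4) : ‖(![1, 1, -1, -1] : Fin 4 → ℂ) α‖ = 1 := by
  fin_cases α <;> simp

/-- **γ₅-hermiticity makes the entry moduli of the Wilson quark propagator symmetric**:
`‖D_W(U,m,r)⁻¹(p,q)‖ = ‖D_W(U,m,r)⁻¹(q,p)‖` for unitary `ρ`, every gauge field, every real `m`, `r`
(from `γ₅ D_W γ₅ = D_W†`, Montvay–Münster (5.15), i.e. `D_W⁻¹ = γ₅ (D_W⁻¹)† γ₅` blockwise with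
`γ₅ = diag(1,1,-1,-1)`). [cite: MontvayMunster1994, §5.1.2 (5.15)] -/
theorem norm_inv_wilsonDirac_apply_comm (hρ : ∀ g, ρ g ∈ Matrix.unitaryGroup (Fin N) ℂ)
    (U : GaugeConfig 4 L G) (m r : ℝ) (p q : TorusSite 4 L × Fin N × Fin 4) :
    ‖(wilsonDirac ρ U m r)⁻¹ p q‖ = ‖(wilsonDirac ρ U m r)⁻¹ q p‖ := by
  have hΓ : diagonal (fun i : TorusSite 4 L × Fin N × Fin 4 => (![1, 1, -1, -1] : Fin 4 → ℂ) i.2.2) *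
      wilsonDirac ρ U m r * diagonal (fun i => (![1, 1, -1, -1] : Fin 4 → ℂ) i.2.2) =
      (wilsonDirac ρ U m r)ᴴ := by
    rw [← spinorLift_gammaFive_eq_diagonal]
    exact wilsonDirac_gammaFive_hermitian_holds ρ hρ U m r
  exact norm_inv_apply_comm_of_signConj
    (fun i : TorusSite 4 L × Fin N × Fin 4 => (![1, 1, -1, -1] : Fin 4 → ℂ) i.2.2)
    (fun i => parity_gammaFiveSign_sq i.2.2) (fun i => parity_norm_gammaFiveSign i.2.2)
    (wilsonDirac ρ U m r) hΓ p q

end Torus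

section QCD

variable {Nf L : ℕ} [NeZero L]

/-- **γ₅-hermiticity of the `N_f`-flavour Wilson matrix**: `diag(ε) D diag(ε) = Dᴴ` for the tree's
flavour-diagonal `diracMatrix` (flavour by flavour `wilsonDirac_gammaFive_hermitian_holds`; the bare
masses are real). [cite: MontvayMunster1994, §5.1.2 (5.15)] -/
theorem diracMatrix_signConj (U : GaugeConfig 4 L SU3) (mq : Fin Nf → ℝ) :
    diagonal (fun P : FermiIdx Nf L => (![1, 1, -1, -1] : Fin 4 → ℂ) (quarkEquiv.symm P).2.2.2) *
        diracMatrix U mq *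
      diagonal (fun P : FermiIdx Nf L => (![1, 1, -1, -1] : Fin 4 → ℂ) (quarkEquiv.symm P).2.2.2) =
      (diracMatrix U mq)ᴴ := by
  have hW : ∀ (f : Fin Nf) (p q : TorusSite 4 L × Fin 3 × Fin 4),
      (![1, 1, -1, -1] : Fin 4 → ℂ) p.2.2 * wilsonDirac (fundamentalRep (Fin 3)) U (mq f) 1 p q *
        (![1, 1, -1, -1] : Fin 4 → ℂ) q.2.2 =
      star (wilsonDirac (fundamentalRep (Fin 3)) U (mq f) 1 q p) := by
    intro f p q
    have hΓ := wilsonDirac_gammaFive_hermitian_holds (L := L) (fundamentalRep (Fin 3))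
      fundamentalRep_mem_unitaryGroup U (mq f) 1
    rw [spinorLift_gammaFive_eq_diagonal] at hΓ
    have h := congr_fun (congr_fun hΓ p) q
    rwa [mul_diagonal, diagonal_mul, conjTranspose_apply] at h
  ext P Q
  obtain ⟨⟨f, p⟩, rfl⟩ := quarkEquiv.surjective P
  obtain ⟨⟨g, q⟩, rfl⟩ := quarkEquiv.surjective Q
  rw [mul_diagonal, diagonal_mul, conjTranspose_apply]
  simp only [diracMatrix, reindex_apply, submatrix_apply, Equiv.symm_apply_apply, of_apply]
  by_cases hfg : f = g
  · subst hfg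
    rw [if_pos rfl, if_pos rfl]
    exact hW f p q
  · rw [if_neg hfg, if_neg (Ne.symm hfg), mul_zero, zero_mul, star_zero]

/-- **Symmetric entry moduli of the `N_f`-flavour quark propagator**:
`‖D(U)⁻¹(P,Q)‖ = ‖D(U)⁻¹(Q,P)‖` for every gauge field and every bare-mass tuple. [cite: MontvayMunster1994, §5.1.2 (5.15)] -/
theorem norm_inv_diracMatrix_apply_comm (U : GaugeConfig 4 L SU3) (mq : Fin Nf → ℝ)
    (P Q : FermiIdx Nf L) : ‖(diracMatrix U mq)⁻¹ P Q‖ = ‖(diracMatrix U mq)⁻¹ Q P‖ := by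
  refine norm_inv_apply_comm_of_signConj
    (fun P : FermiIdx Nf L => (![1, 1, -1, -1] : Fin 4 → ℂ) (quarkEquiv.symm P).2.2.2)
    (fun R => ?_) (fun R => ?_) (diracMatrix U mq) (diracMatrix_signConj U mq) P Q
  · exact gammaFiveSign_mul_self ((quarkEquiv.symm R).2.2.2)
  · exact parity_norm_gammaFiveSign ((quarkEquiv.symm R).2.2.2)

/-! ### §3 Phase-quenched two-point moments: symmetry and parity -/

/-- Reordering a fourfold sum: `Σ_a Σ_i Σ_b Σ_j g a i b j = Σ_b Σ_j Σ_a Σ_i g a i b j`. [folklore] -/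
private theorem parity_sum_four_comm {α β γ δ : Type*} [Fintype α] [Fintype β] [Fintype γ]
    [Fintype δ] (g : α → β → γ → δ → ℝ) :
    ∑ a, ∑ i, ∑ b, ∑ j, g a i b j = ∑ b, ∑ j, ∑ a, ∑ i, g a i b j := by
  calc ∑ a, ∑ i, ∑ b, ∑ j, g a i b j = ∑ a, ∑ b, ∑ i, ∑ j, g a i b j :=
        Finset.sum_congr rfl fun _ _ => Finset.sum_comm
    _ = ∑ b, ∑ a, ∑ i, ∑ j, g a i b j := Finset.sum_comm
    _ = ∑ b, ∑ a, ∑ j, ∑ i, g a i b j :=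
        Finset.sum_congr rfl fun _ _ => Finset.sum_congr rfl fun _ _ => Finset.sum_comm
    _ = ∑ b, ∑ j, ∑ a, ∑ i, g a i b j := Finset.sum_congr rfl fun _ _ => Finset.sum_comm

/-- **The colour–spin entry sum of the quark propagator is symmetric in source and sink,
configuration-wise**: `Σ_{a,i,b,j}|G_f((x,a,i),(y,b,j))| = Σ_{a,i,b,j}|G_f((y,a,i),(x,b,j))|` for
every gauge field (γ₅-hermiticity, `norm_inv_diracMatrix_apply_comm`). [cite: MontvayMunster1994, §5.1.2 (5.15)] -/
theorem propagatorBlockSum_comm (U : GaugeConfig 4 L SU3) (mq : Fin Nf → ℝ) (f : Fin Nf)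
    (x y : TorusSite 4 L) :
    (∑ a : Fin 3, ∑ i : Fin 4, ∑ b : Fin 3, ∑ j : Fin 4,
        ‖(diracMatrix U mq)⁻¹ (quarkEquiv (f, (x, a, i))) (quarkEquiv (f, (y, b, j)))‖) =
      ∑ a : Fin 3, ∑ i : Fin 4, ∑ b : Fin 3, ∑ j : Fin 4,
        ‖(diracMatrix U mq)⁻¹ (quarkEquiv (f, (y, a, i))) (quarkEquiv (f, (x, b, j)))‖ := by
  rw [parity_sum_four_comm (fun a i b j =>
    ‖(diracMatrix U mq)⁻¹ (quarkEquiv (f, (y, a, i))) (quarkEquiv (f, (x, b, j)))‖)]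
  refine Finset.sum_congr rfl fun a _ => Finset.sum_congr rfl fun i _ =>
    Finset.sum_congr rfl fun b _ => Finset.sum_congr rfl fun j _ => ?_
  exact norm_inv_diracMatrix_apply_comm U mq _ _

/-- **Phase-quenched two-point moments are symmetric under exchange of source and sink** (the
literal `|det D|`-weighted Wilson integral of the QCD theses, integer sites `x, y ∈ ℤ⁴` read on the
torus of side `L`, any exponent `s`). [cite: MontvayMunster1994, §5.1.2 (5.15)] -/
theorem phaseQuenched_twoPoint_swap (β : ℝ) (mq : Fin Nf → ℝ) (f : Fin Nf) (s : ℝ)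
    (x y : Literature.Probability.LatticeModels.Site 4) :
    (∫ U : GaugeConfig 4 L SU3, ‖(diracMatrix U mq).det‖ *
        (∑ a : Fin 3, ∑ i : Fin 4, ∑ b : Fin 3, ∑ j : Fin 4,
          ‖(diracMatrix U mq)⁻¹ (quarkEquiv (f, (Torus.proj L x, a, i)))
            (quarkEquiv (f, (Torus.proj L y, b, j)))‖) ^ s
        ∂(wilsonMeasure (fundamentalRep (Fin 3)) β)) =
      ∫ U : GaugeConfig 4 L SU3, ‖(diracMatrix U mq).det‖ *
        (∑ a : Fin 3, ∑ i : Fin 4, ∑ b : Fin 3, ∑ j : Fin 4,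
          ‖(diracMatrix U mq)⁻¹ (quarkEquiv (f, (Torus.proj L y, a, i)))
            (quarkEquiv (f, (Torus.proj L x, b, j)))‖) ^ s
        ∂(wilsonMeasure (fundamentalRep (Fin 3)) β) := by
  refine integral_congr_ae (Eventually.of_forall fun U => ?_)
  simp only [propagatorBlockSum_comm U mq f (Torus.proj L x) (Torus.proj L y)]

/-- **Phase-quenched two-point moments are even in the separation**: the `|det D|`-weighted Wilson
integral of `(Σ_{a,i,b,j}|G_f((0,a,i),(−v,b,j))|)^s` equals that of `(Σ|G_f((0,a,i),(v,b,j))|)^s`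
(swap source and sink, then translate by `v`: `phaseQuenched_twoPoint_translate`). [cite: MontvayMunster1994, §5.1.2 (5.15)] -/
theorem phaseQuenched_twoPoint_neg (β : ℝ) (mq : Fin Nf → ℝ) (f : Fin Nf) (s : ℝ)
    (v : Literature.Probability.LatticeModels.Site 4) :
    (∫ U : GaugeConfig 4 L SU3, ‖(diracMatrix U mq).det‖ *
        (∑ a : Fin 3, ∑ i : Fin 4, ∑ b : Fin 3, ∑ j : Fin 4,
          ‖(diracMatrix U mq)⁻¹ (quarkEquiv (f, (Torus.proj L 0, a, i)))
            (quarkEquiv (f, (Torus.proj L (-v), b, j)))‖) ^ s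
        ∂(wilsonMeasure (fundamentalRep (Fin 3)) β)) =
      ∫ U : GaugeConfig 4 L SU3, ‖(diracMatrix U mq).det‖ *
        (∑ a : Fin 3, ∑ i : Fin 4, ∑ b : Fin 3, ∑ j : Fin 4,
          ‖(diracMatrix U mq)⁻¹ (quarkEquiv (f, (Torus.proj L 0, a, i)))
            (quarkEquiv (f, (Torus.proj L v, b, j)))‖) ^ s
        ∂(wilsonMeasure (fundamentalRep (Fin 3)) β) := by
  rw [phaseQuenched_twoPoint_swap β mq f s 0 (-v)]
  have h := phaseQuenched_twoPoint_translate (L := L) β mq f s (-v) 0 v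
  rw [neg_add_cancel, zero_add] at h
  exact h.symm

/-! ### §4 The folded star bound -/

/-- `Pi.single μ (-1) = -(Pi.single μ 1)` in `ℤ⁴`. [folklore] -/
private theorem parity_single_neg_one (μ : Fin 4) :
    (Pi.single μ (-1 : ℤ) : Literature.Probability.LatticeModels.Site 4) = -Pi.single μ (1 : ℤ) := by
  rw [← Pi.single_neg]

/-- **Folded star bound — the phase-quenched fractional moments of the quark propagator at the
source and at its four FORWARD neighbours cannot all be small** (every bare-mass tuple, coupling,
volume, flavour; `0 < s ≤ 1`):
`12^s ≤ |m_f+4|^s · E_{|w|,β,S}[(Σ|G_f(0,0)|)^s] + 2 Σ_μ E_{|w|,β,S}[(Σ|G_f(0,μ̂)|)^s]`.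
The star sum rule `phaseQuenched_starMoment_ge` with its backward terms folded onto the forward
ones by parity (`phaseQuenched_twoPoint_neg`). [folklore] -/
theorem phaseQuenched_starMoment_ge_folded (Nf : ℕ) (β : ℝ) (mq : Fin Nf → ℝ) (S : ℕ) (f : Fin Nf)
    {s : ℝ} (hs0 : 0 < s) (hs1 : s ≤ 1) :
    (12 : ℝ) ^ s ≤
      |mq f + 4| ^ s *
          ((∫ U : GaugeConfig 4 (2 * S + 1) (Matrix.specialUnitaryGroup (Fin 3) ℂ),
              ‖(diracMatrix U mq).det‖ *
                (∑ a : Fin 3, ∑ i : Fin 4, ∑ b : Fin 3, ∑ j : Fin 4,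
                  ‖(diracMatrix U mq)⁻¹ (quarkEquiv (f, (Torus.proj (2 * S + 1) 0, a, i)))
                    (quarkEquiv (f, (Torus.proj (2 * S + 1) 0, b, j)))‖) ^ s
              ∂(wilsonMeasure (fundamentalRep (Fin 3)) β)) /
            (∫ U : GaugeConfig 4 (2 * S + 1) (Matrix.specialUnitaryGroup (Fin 3) ℂ),
              ‖(diracMatrix U mq).det‖ ∂(wilsonMeasure (fundamentalRep (Fin 3)) β))) +
        2 * ∑ μ : Fin 4,
          ((∫ U : GaugeConfig 4 (2 * S + 1) (Matrix.specialUnitaryGroup (Fin 3) ℂ),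
              ‖(diracMatrix U mq).det‖ *
                (∑ a : Fin 3, ∑ i : Fin 4, ∑ b : Fin 3, ∑ j : Fin 4,
                  ‖(diracMatrix U mq)⁻¹ (quarkEquiv (f, (Torus.proj (2 * S + 1) 0, a, i)))
                    (quarkEquiv (f, (Torus.proj (2 * S + 1) (Pi.single μ (1 : ℤ)), b, j)))‖) ^ s
              ∂(wilsonMeasure (fundamentalRep (Fin 3)) β)) /
            (∫ U : GaugeConfig 4 (2 * S + 1) (Matrix.specialUnitaryGroup (Fin 3) ℂ),
              ‖(diracMatrix U mq).det‖ ∂(wilsonMeasure (fundamentalRep (Fin 3)) β))) := by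
  have h := phaseQuenched_starMoment_ge Nf β mq S f hs0 hs1
  have hneg : ∀ μ : Fin 4,
      (∫ U : GaugeConfig 4 (2 * S + 1) (Matrix.specialUnitaryGroup (Fin 3) ℂ),
          ‖(diracMatrix U mq).det‖ *
            (∑ a : Fin 3, ∑ i : Fin 4, ∑ b : Fin 3, ∑ j : Fin 4,
              ‖(diracMatrix U mq)⁻¹ (quarkEquiv (f, (Torus.proj (2 * S + 1) 0, a, i)))
                (quarkEquiv (f, (Torus.proj (2 * S + 1) (Pi.single μ (-1 : ℤ)), b, j)))‖) ^ s
          ∂(wilsonMeasure (fundamentalRep (Fin 3)) β)) =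
        ∫ U : GaugeConfig 4 (2 * S + 1) (Matrix.specialUnitaryGroup (Fin 3) ℂ),
          ‖(diracMatrix U mq).det‖ *
            (∑ a : Fin 3, ∑ i : Fin 4, ∑ b : Fin 3, ∑ j : Fin 4,
              ‖(diracMatrix U mq)⁻¹ (quarkEquiv (f, (Torus.proj (2 * S + 1) 0, a, i)))
                (quarkEquiv (f, (Torus.proj (2 * S + 1) (Pi.single μ (1 : ℤ)), b, j)))‖) ^ s
          ∂(wilsonMeasure (fundamentalRep (Fin 3)) β) := fun μ => by
    rw [parity_single_neg_one]
    exact phaseQuenched_twoPoint_neg (L := 2 * S + 1) β mq f s (Pi.single μ (1 : ℤ))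
  simp only [hneg, ← two_mul] at h
  rwa [← Finset.mul_sum] at h

end QCD

end Literature.MathematicalPhysics.QuantumFieldTheory

end
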